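import Summits.AtomisticToContinuum.HydrodynamicLimit.Theorems.ImplosionDichotomyEosContinuity
import Summits.AtomisticToContinuum.HydrodynamicLimit.Theorems.DenseExcursion.Negative.Dichotomy
import Literature.MathematicalPhysics.KineticTheory.HardSphereEulerContinuousDependenceHolds
import Literature.Analysis.FunctionSpaces.TorusSpaceTime

/-!
# `EosContinuity` holds, and the PRE-SINGULAR DILUTENESS (piece B.1 of the time split) of the crux
# `DiluteSelfConsistency` (stmt-AtomisticToContinuum-3091) is a theorem

Line `birth` rev c3 of the crux `ImplosionDichotomy.DiluteSelfConsistency` (lead prover-line-stmt-AtomisticToContinuum-3091-c3-0).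
With the named fact `hsEuler_continuousDependence` now DISCHARGED (`hsEuler_continuousDependence_holds`,
`Literature/MathematicalPhysics/KineticTheory/HardSphereEulerContinuousDependenceHolds.lean`: Kato 1975 Thm III for the
hard-sphere Euler family, layers 1–4), the route support `EosContinuity` (stmt-AtomisticToContinuum-12589) follows from
its landed conditional closer `eosContinuity_proof` — `eosContinuity_holds` — and with it piece B.1 of the time split
of the crux (crux-strategist r1, `Cruxes/DiluteSelfConsistency/StrategistSketchR1.lean` §B): for every level `η > 0`,
all continuous positive profiles, every ideal-gas classical development of the reference data on `[0, T₁)` and every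
`T₂ < T₁`, below a threshold `σ₀(η, profiles, T₂) > 0` EVERY classical hard-sphere Euler σ-solution tied to the local
Gibbs data at `t = 0` has packing `ρσ³ < η` on `[0, min(T, T₂)]` — **the crux can only fail at or after the first
singular time of the ideal development** (`diluteSelfConsistency_preSingular`).
-/

noncomputable section

namespace Summit.AtomisticToContinuum.HydrodynamicLimit.Theorems

open MeasureTheory Filter Set Topology
open Literature.MathematicalPhysics.KineticTheory Literature.Analysis.FluidPDE Literature.Analysis.FunctionSpaces
open Summit.AtomisticToContinuum.HydrodynamicLimit.Theses.ImplosionDichotomy (EosContinuity)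
open Summit.AtomisticToContinuum.HydrodynamicLimit.Theorems.DenseExcursionDichotomy (tendstoHydroFieldsAt_zero_transfer)

/-- **`EosContinuity` (stmt-AtomisticToContinuum-12589) holds**: the landed conditional closer `eosContinuity_proof` fed
with the discharged named fact `hsEuler_continuousDependence_holds`. [cite: Kato1975, Thm III] -/
theorem eosContinuity_holds : EosContinuity :=
  eosContinuity_proof hsEuler_continuousDependence_holds

/-- **Pre-singular diluteness (piece B.1 of the time split of `DiluteSelfConsistency`).** For every `η > 0`, all
continuous positive profiles `(a₀, θ₀, u₀)`, every classical ideal-gas development `(ρ₁, u₁, θ₁)` of the reference data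
`(a₀/∫a₀, u₀, θ₀)` on `[0, T₁)` and every `0 < T₂ < T₁` there is `σ₀ > 0` such that for `0 < σ < σ₀` every classical
hard-sphere Euler σ-solution on `[0, T)` tied at `t = 0` to the local Gibbs data has packing `ρ_t(x)σ³ < η` for all
`t ∈ [0, T)` with `t ≤ T₂`: sup `C` of the ideal density on the compact slab `[0, T₂] × 𝕋³`, `EosContinuity` with
tolerance `1`, and `(C + 1)σ³ < η` for `σ < min(1, η/(C+1))`; the one-flow tie is the all-flow tie.
[cite: Kato1975, Thm III] [cite: Majda1984] -/
theorem diluteSelfConsistency_preSingular :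
    ∀ η : ℝ, 0 < η → ∀ (a₀ θ₀ : T3 → ℝ) (u₀ : T3 → V3), Continuous a₀ → Continuous θ₀ → Continuous u₀ →
      (∀ x, 0 < a₀ x) → (∀ x, 0 < θ₀ x) →
      ∀ (T₁ : ℝ) (ρ₁ θ₁ : ℝ → T3 → ℝ) (u₁ : ℝ → T3 → V3), IsHardSphereEulerSolution 0 T₁ ρ₁ u₁ θ₁ →
        (∀ x, ρ₁ 0 x = a₀ x / ∫ y, a₀ y) → u₁ 0 = u₀ → θ₁ 0 = θ₀ → ∀ T₂ : ℝ, 0 < T₂ → T₂ < T₁ →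
        ∃ σ₀ : ℝ, 0 < σ₀ ∧ ∀ σ : ℝ, 0 < σ → σ < σ₀ →
          ∀ (T : ℝ) (ρ θ : ℝ → T3 → ℝ) (u : ℝ → T3 → V3), IsHardSphereEulerSolution σ T ρ u θ →
            ∀ Φ : (N : ℕ) → HardSphereFlow (Torus.geometry (Fin 3)) (hsDiameter σ N) (N + 1),
              TendstoHydroFieldsAt (fun N => localGibbsLaw σ a₀ u₀ θ₀ N (Φ N)) Φ ρ u θ 0 →
                ∀ t ∈ Ico 0 T, t ≤ T₂ → ∀ x, ρ t x * σ ^ 3 < η := by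
  -- adapted from Cruxes/DiluteSelfConsistency/StrategistSketchR1.lean (planner-cstrat-…-3091-r1-0)
  intro η hη a₀ θ₀ u₀ ha hθ hu ha0 hθ0 T₁ ρ₁ θ₁ u₁ hsol h0 hu0 hθ₀ T₂ hT₂ hT₂1
  obtain ⟨C, hC⟩ := hsol.smooth_density.exists_norm_le_of_isCompact isCompact_Icc
    (fun t ht => ⟨ht.1, lt_of_le_of_lt ht.2 hT₂1⟩)
  have hC0 : 0 ≤ C := le_trans (norm_nonneg _) (hC 0 ⟨le_rfl, hT₂.le⟩ 0)
  obtain ⟨σ₁, hσ₁, H⟩ := eosContinuity_holds a₀ θ₀ u₀ ha hθ hu ha0 hθ0 T₁ ρ₁ θ₁ u₁ hsol h0 hu0 hθ₀ T₂ hT₂ hT₂1 1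
    one_pos
  refine ⟨min σ₁ (min 1 (η / (C + 1))), lt_min hσ₁ (lt_min one_pos (div_pos hη (by linarith))), ?_⟩
  intro σ hσ hσlt T ρ θ u hsolσ Φ htie t ht htT₂ x
  have hσ₁' : σ < σ₁ := lt_of_lt_of_le hσlt (min_le_left _ _)
  have hσ1 : σ < 1 := lt_of_lt_of_le hσlt ((min_le_right _ _).trans (min_le_left _ _))
  have hση : σ < η / (C + 1) := lt_of_lt_of_le hσlt ((min_le_right _ _).trans (min_le_right _ _))
  have hclose := (H σ hσ hσ₁').2 T ρ θ u hsolσ (fun Ψ => tendstoHydroFieldsAt_zero_transfer Φ Ψ htie) t ht htT₂ x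
  have hρ₁ : ρ₁ t x ≤ C := le_trans (Real.le_norm_self _) (hC t ⟨ht.1, htT₂⟩ x)
  have hρ : ρ t x < C + 1 := by
    have := (abs_lt.1 hclose).2
    linarith
  have hσ3 : σ ^ 3 ≤ σ := by
    have h1 : σ ^ 3 ≤ σ ^ 1 := pow_le_pow_of_le_one hσ.le hσ1.le (by norm_num)
    simpa using h1
  have hC1 : 0 < C + 1 := by linarith
  have hρpos : 0 < ρ t x := hsolσ.density_pos t ht x
  calc ρ t x * σ ^ 3 ≤ ρ t x * σ := mul_le_mul_of_nonneg_left hσ3 hρpos.le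
    _ < (C + 1) * (η / (C + 1)) := mul_lt_mul'' hρ hση hρpos.le hσ.le
    _ = η := by field_simp

end Summit.AtomisticToContinuum.HydrodynamicLimit.Theorems

end
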